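import Literature.AlgebraicGeometry.Motives.AbelianVarietyLatticeTensorDecomposition
import Literature.AlgebraicGeometry.Motives.AbelianVarietyLatticeTensorFiniteSums
import HarnessLib

/-!
# Character relations give dimension relations for twisted lattice tensors:
# `Σ_w k_w tr m_w|_H = 0 ⟹ Σ_w k_w dim B_H(Y ⊗_β M_w) = 0`, `Σ_w k_w c_W·tr m_w = 0 ⟹ Σ_w k_w dim B_W(Y ⊗_β M_w) = 0`;
# hence `dim B_H`, `dim B_W` of TWISTED tensors are additive under `M_ℚ ≅ ⊕_w (M_w)_ℚ` (Mazur–Rubin–Silverberg Cor. 2.5, Thm. 4.5)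

Sequel of `Motives/AbelianVarietyLatticeTensorDecomposition` (binary, untwisted numerics) and `Motives/AbelianVarietyLatticeTensorFiniteSums`
(`n`-ary, untwisted numerics).  For twisted lattice tensors `X_w = Y ⊗_β M_w` over a COMMON `(Y, β)` (bicones `b_w`, matrix representations
`m_w`, actions `ρ_w` with `ι_j ρ_w(g) π_i = m_w(g)_{ij} • β(g)`) the `ℓ`-adic character is `χ_{X_w}(g) = tr m_w(g) · χ_β(g)` (the tree's
`trace_tateModuleMap_asHom_eq_trace_mul`), so every integral linear relation among the characters `tr m_w` is inherited by the
characters `χ_{X_w}` and hence — through `|H| · 2 dim B_H = Σ_{h ∈ H} χ(h)` and `|G| · 2 dim B_W = Σ_g c_W(g) χ(g)` — by the dimensions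
of the Kani–Rosen factors `B_H = Im Σ_{h ∈ H} ρ(h)` and of the isotypical components `B_W = Im u_W`.  Proved here (no definitions), over ANY
field (an auxiliary prime `ℓ` invertible in `K` is chosen inside the proofs):

* §1 the master statements **`Σ_w k_w tr m_w(h) = 0 (h ∈ H) ⟹ Σ_w k_w dim B_H(Y ⊗_β M_w) = 0`** (`sum_zsmul_dim_image_norm_eq_zero`) and
  **`Σ_w k_w tr m_w(g) = 0 (g ∈ G) ⟹ Σ_w k_w dim B_W(Y ⊗_β M_w) = 0`** (`sum_zsmul_dim_isotypical_eq_zero`) for integer coefficients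
  `k_w` — "idempotent (character) relations give dimension relations" (Kani–Rosen Thm. B for the family `Y ⊗_β M_w`); the one-against-many
  forms **`tr m|_H = Σ_w tr m_w|_H ⟹ dim B_H(Y ⊗_β M) = Σ_w dim B_H(Y ⊗_β M_w)`** (`dim_image_norm_eq_sum_of_trace_eq_sum`) and
  `dim B_W(Y ⊗_β M) = Σ_w dim B_W(Y ⊗_β M_w)` (`dim_isotypical_eq_sum_of_trace_eq_sum`);
* §2 the TWISTED decomposition numerics: an integral intertwiner `P m(g) = diag(m_w(g))_w P` (`Matrix.blockDiagonal'`) resp.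
  `P m(g) = diag(m₁(g), m₂(g)) P` (`Matrix.fromBlocks`) with a quasi-inverse (`Q P = d · 1 = P Q`, `d ≠ 0`; i.e. `M_ℚ ≅ ⊕_w (M_w)_ℚ`) gives
  **`dim B_H(Y ⊗_β M) = Σ_w dim B_H(Y ⊗_β M_w)`**, **`dim B_W(Y ⊗_β M) = Σ_w dim B_W(Y ⊗_β M_w)`** and their binary forms — the twisted
  (`β ≠ 1`) versions of `dim_image_norm_eq_sum_of_intertwines` / `dim_image_norm_eq_add_of_intertwines` of the prequels
  ("`Res V ∼ ⊕_ρ I_ρ ⊗ V`", MRS Thm. 4.5, factor by factor).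

## References

* [KaniRosen1989] E. Kani, M. Rosen, *Idempotent relations and factors of Jacobians*, Math. Ann. 284 (1989) 307–327, §3 Thm. B
  (character / idempotent relations imply dimension and isogeny relations among the `B_H`).
* [MazurRubinSilverberg2007] B. Mazur, K. Rubin, A. Silverberg, *Twisting commutative algebraic groups*, J. Algebra 314 (2007)
  419–438: Thm. 2.1 (i) (`dim(I ⊗ V) = rank(I) dim V`), Cor. 2.5, Def. 4.3, Thm. 4.5.  Held: `paper:doi-10-1016-j-jalgebra-2007-02-052`,
  PDF pp. 5–7, 10 read 2026-08-28.
* [LangeRodriguez2022] H. Lange, R. E. Rodríguez, *Decomposition of Jacobians by Prym Varieties*, LNM 2310 (2022), §2.9.1 Thm. 2.9.1,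
  Cor. 2.9.2, Prop. 2.9.3 (PDF pp. 43, 46).
* [SerreLinearRepresentations1977] J.-P. Serre, *Linear Representations of Finite Groups*, GTM 42 (1977): §2.1 Prop. 2 (i), (ii)
  (characters of `⊕`, `⊗`, PDF p. 15), §2.3, §2.6 Thm. 8.
* [MumfordAV1970] D. Mumford, *Abelian Varieties* (1970), §19 Thm. 3–4 (pp. 176–180).
-/

noncomputable section

open CategoryTheory CategoryTheory.Limits
open Literature.NumberTheory.DiophantineGeometry
open Literature.RepresentationTheory.FiniteGroups

universe u

namespace Literature.AlgebraicGeometry.Motives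

namespace AbelianVariety

namespace LatticeTensor

variable {K : Type u} [Field K]

/-! ## §1 Character relations ⟹ dimension relations -/

section Relations

variable {Y : AbelianVariety K} {W : Type} [Fintype W] {ι : W → Type} [∀ w, Fintype (ι w)] [∀ w, DecidableEq (ι w)]
  (bw : ∀ w, Bicone (fun _ : ι w ↦ Y)) {G : Type} [Group G] (mw : ∀ w, G →* Matrix (ι w) (ι w) ℤ) (β : G →* End Y)
  (ρw : ∀ w, G →* End (bw w).pt)

/-- **Character relations give dimension relations (Kani–Rosen Thm. B for the twisted tensors `Y ⊗_β M_w`)**: if integers `k_w` satisfy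
**`Σ_w k_w tr m_w(h) = 0` for all `h ∈ H`** (`H` a finite subgroup), then **`Σ_w k_w dim B_H(Y ⊗_β M_w) = 0`**, `B_H = Im Σ_{h ∈ H} ρ_w(h)`,
over ANY field: `|H| · 2 dim B_H(X_w) = Σ_h tr m_w(h) χ_β(h)` for an auxiliary `ℓ`. [cite: KaniRosen1989, §3 Thm. B]
[cite: LangeRodriguez2022, §2.9.1 Prop. 2.9.3 (PDF p. 46)] [cite: SerreLinearRepresentations1977, §2.1 Prop. 2 (ii) and §2.3] -/
theorem sum_zsmul_dim_image_norm_eq_zero {H : Subgroup G} [Fintype H] (hbw : ∀ w, ∑ i, (bw w).π i ≫ (bw w).ι i = 𝟙 (bw w).pt)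
    (hρw : ∀ (w : W) (g : G) (i j : ι w), (bw w).ι j ≫ End.asHom (ρw w g) ≫ (bw w).π i = mw w g i j • End.asHom (β g))
    {k : W → ℤ} (hk : ∀ h : H, ∑ w, k w * (mw w h).trace = 0)
    {Nw : ∀ w, (bw w).pt ⟶ (bw w).pt} (hNw : ∀ w, End.of (Nw w) = ∑ h : H, ρw w h) :
    ∑ w, k w * ((image (Nw w)).dim : ℤ) = 0 := by
  obtain ⟨ℓ, hℓp, hℓ⟩ := exists_prime_natCast_ne_zero (K := K)
  haveI : Fact ℓ.Prime := ⟨hℓp⟩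
  have hw := fun w ↦ card_mul_two_mul_dim_image_norm_eq_sum_trace_mul (bw w) (mw w) β (ρw w) ℓ (hbw w) (hρw w) hℓ (hNw w)
  -- `|H| · 2 · Σ_w k_w dim_w = Σ_h χ_β(h) Σ_w k_w tr m_w(h) = 0` in `ℤ_ℓ`
  have key : ((Fintype.card H : ℤ) * (2 * ∑ w, k w * ((image (Nw w)).dim : ℤ)) : ℤ_[ℓ]) = 0 := by
    have h1 : ((Fintype.card H : ℤ) * (2 * ∑ w, k w * ((image (Nw w)).dim : ℤ)) : ℤ_[ℓ]) =
        ∑ w, (k w : ℤ_[ℓ]) * ((Fintype.card H * (2 * (image (Nw w)).dim) : ℕ) : ℤ_[ℓ]) := by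
      push_cast
      rw [Finset.mul_sum, Finset.mul_sum]
      exact Finset.sum_congr rfl fun w _ ↦ by ring
    rw [h1, Finset.sum_congr rfl fun w _ ↦ by rw [hw w, Finset.mul_sum], Finset.sum_comm]
    refine Finset.sum_eq_zero fun h _ ↦ ?_
    have hk' : ∑ w, (k w : ℤ_[ℓ]) * ((mw w h).trace : ℤ_[ℓ]) = 0 := by exact_mod_cast congrArg (Int.cast (R := ℤ_[ℓ])) (hk h)
    calc ∑ w, (k w : ℤ_[ℓ]) * (((mw w h).trace : ℤ_[ℓ]) * LinearMap.trace ℤ_[ℓ] (Y.tateModule ℓ) (tateModuleMap ℓ (End.asHom (β h))))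
        = (∑ w, (k w : ℤ_[ℓ]) * ((mw w h).trace : ℤ_[ℓ])) * LinearMap.trace ℤ_[ℓ] (Y.tateModule ℓ) (tateModuleMap ℓ (End.asHom (β h))) := by
          rw [Finset.sum_mul]; exact Finset.sum_congr rfl fun w _ ↦ by ring
      _ = 0 := by rw [hk', zero_mul]
  have key' : (Fintype.card H : ℤ) * (2 * ∑ w, k w * ((image (Nw w)).dim : ℤ)) = 0 := by exact_mod_cast key
  have hc : (Fintype.card H : ℤ) ≠ 0 := by exact_mod_cast Fintype.card_ne_zero
  simpa [hc] using key'

/-- **`tr m|_H = Σ_w tr m_w|_H ⟹ dim B_H(Y ⊗_β M) = Σ_w dim B_H(Y ⊗_β M_w)`** over ANY field, for twisted lattice tensors over a common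
`(Y, β)` and a finite subgroup `H` (`B_H = Im Σ_{h ∈ H} ρ(h)`) — "`χ_{⊕ M_w} = Σ χ_{M_w}`" on the abelian-variety side.
[cite: KaniRosen1989, §3 Thm. B] [cite: SerreLinearRepresentations1977, §2.1 Prop. 2 (i), (ii) (PDF p. 15)] [cite: LangeRodriguez2022, §2.9.1 Prop. 2.9.3 (PDF p. 46)] -/
theorem dim_image_norm_eq_sum_of_trace_eq_sum {κ : Type} [Fintype κ] [DecidableEq κ] (b : Bicone (fun _ : κ ↦ Y))
    (m : G →* Matrix κ κ ℤ) (ρ : G →* End b.pt) {H : Subgroup G} [Fintype H] (hb : ∑ j, b.π j ≫ b.ι j = 𝟙 b.pt)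
    (hbw : ∀ w, ∑ i, (bw w).π i ≫ (bw w).ι i = 𝟙 (bw w).pt)
    (hρ : ∀ (g : G) (i j : κ), b.ι j ≫ End.asHom (ρ g) ≫ b.π i = m g i j • End.asHom (β g))
    (hρw : ∀ (w : W) (g : G) (i j : ι w), (bw w).ι j ≫ End.asHom (ρw w g) ≫ (bw w).π i = mw w g i j • End.asHom (β g))
    (htr : ∀ h : H, (m h).trace = ∑ w, (mw w h).trace)
    {N : b.pt ⟶ b.pt} (hN : End.of N = ∑ h : H, ρ h) {Nw : ∀ w, (bw w).pt ⟶ (bw w).pt} (hNw : ∀ w, End.of (Nw w) = ∑ h : H, ρw w h) :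
    (image N).dim = ∑ w, (image (Nw w)).dim := by
  obtain ⟨ℓ, hℓp, hℓ⟩ := exists_prime_natCast_ne_zero (K := K)
  haveI : Fact ℓ.Prime := ⟨hℓp⟩
  have h := card_mul_two_mul_dim_image_norm_eq_sum_trace_mul b m β ρ ℓ hb hρ hℓ hN
  have hw := fun w ↦ card_mul_two_mul_dim_image_norm_eq_sum_trace_mul (bw w) (mw w) β (ρw w) ℓ (hbw w) (hρw w) hℓ (hNw w)
  have key : ((Fintype.card H * (2 * (image N).dim) : ℕ) : ℤ_[ℓ]) = ((Fintype.card H * (2 * ∑ w, (image (Nw w)).dim) : ℕ) : ℤ_[ℓ]) := by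
    rw [h, Finset.mul_sum, Finset.mul_sum, Nat.cast_sum, Finset.sum_congr rfl fun w _ ↦ hw w, Finset.sum_comm]
    refine Finset.sum_congr rfl fun h' _ ↦ ?_
    rw [htr h', Int.cast_sum, Finset.sum_mul]
  have key' := Nat.eq_of_mul_eq_mul_left (Fintype.card_pos (α := H)) (Nat.cast_injective key)
  omega

variable [Fintype G] {a : ratCharIdempotents G → G → ℤ}
  (ha : ∀ e : ratCharIdempotents G,
    (Fintype.card G : ℚ) • (e : MonoidAlgebra ℚ G) = ∑ g, (a e g : ℚ) • MonoidAlgebra.of ℚ G g)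
  {uw : ratCharIdempotents G → ∀ w, ((bw w).pt ⟶ (bw w).pt)} (huw : ∀ e w, End.of (uw e w) = ∑ g, a e g • ρw w g)

include ha huw

/-- **Character relations give isotypical dimension relations**: if **`Σ_w k_w tr m_w(g) = 0` for all `g`**, then
**`Σ_w k_w dim B_W(Y ⊗_β M_w) = 0`** for every isotypical component `B_W = Im u_W`, `u_W = Σ_g c_W(g) ρ(g)` (same `c` for all `w`), over
ANY field: `|G| · 2 dim B_W(X_w) = Σ_g c_W(g) tr m_w(g) χ_β(g)`. [cite: KaniRosen1989, §3 Thm. B] [cite: LangeRodriguez2022, §2.9.1 Thm. 2.9.1 (PDF p. 43)]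
[cite: SerreLinearRepresentations1977, §2.1 Prop. 2 (ii) and §2.6 Thm. 8] -/
theorem sum_zsmul_dim_isotypical_eq_zero (hbw : ∀ w, ∑ i, (bw w).π i ≫ (bw w).ι i = 𝟙 (bw w).pt)
    (hρw : ∀ (w : W) (g : G) (i j : ι w), (bw w).ι j ≫ End.asHom (ρw w g) ≫ (bw w).π i = mw w g i j • End.asHom (β g))
    {k : W → ℤ} (hk : ∀ g : G, ∑ w, k w * (mw w g).trace = 0) (e : ratCharIdempotents G) :
    ∑ w, k w * ((image (uw e w)).dim : ℤ) = 0 := by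
  obtain ⟨ℓ, hℓp, hℓ⟩ := exists_prime_natCast_ne_zero (K := K)
  haveI : Fact ℓ.Prime := ⟨hℓp⟩
  have hw := fun w ↦ card_mul_two_mul_dim_isotypical_eq_sum_trace_mul (bw w) (mw w) β (ρw w) ha (huw · w) ℓ (hbw w) (hρw w) hℓ e
  have key : ((Fintype.card G : ℤ) * (2 * ∑ w, k w * ((image (uw e w)).dim : ℤ)) : ℤ_[ℓ]) = 0 := by
    have h1 : ((Fintype.card G : ℤ) * (2 * ∑ w, k w * ((image (uw e w)).dim : ℤ)) : ℤ_[ℓ]) =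
        ∑ w, (k w : ℤ_[ℓ]) * ((Fintype.card G * (2 * (image (uw e w)).dim) : ℕ) : ℤ_[ℓ]) := by
      push_cast
      rw [Finset.mul_sum, Finset.mul_sum]
      exact Finset.sum_congr rfl fun w _ ↦ by ring
    rw [h1, Finset.sum_congr rfl fun w _ ↦ by rw [hw w, Finset.mul_sum], Finset.sum_comm]
    refine Finset.sum_eq_zero fun g _ ↦ ?_
    have hk' : ∑ w, (k w : ℤ_[ℓ]) * ((mw w g).trace : ℤ_[ℓ]) = 0 := by exact_mod_cast congrArg (Int.cast (R := ℤ_[ℓ])) (hk g)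
    calc ∑ w, (k w : ℤ_[ℓ]) * ((a e g : ℤ_[ℓ]) *
          (((mw w g).trace : ℤ_[ℓ]) * LinearMap.trace ℤ_[ℓ] (Y.tateModule ℓ) (tateModuleMap ℓ (End.asHom (β g)))))
        = (a e g : ℤ_[ℓ]) * LinearMap.trace ℤ_[ℓ] (Y.tateModule ℓ) (tateModuleMap ℓ (End.asHom (β g))) *
            ∑ w, (k w : ℤ_[ℓ]) * ((mw w g).trace : ℤ_[ℓ]) := by
          rw [Finset.mul_sum]; exact Finset.sum_congr rfl fun w _ ↦ by ring
      _ = 0 := by rw [hk', mul_zero]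
  have key' : (Fintype.card G : ℤ) * (2 * ∑ w, k w * ((image (uw e w)).dim : ℤ)) = 0 := by exact_mod_cast key
  have hc : (Fintype.card G : ℤ) ≠ 0 := by exact_mod_cast Fintype.card_ne_zero
  simpa [hc] using key'

/-- **`tr m = Σ_w tr m_w ⟹ dim B_W(Y ⊗_β M) = Σ_w dim B_W(Y ⊗_β M_w)`** over ANY field for every isotypical component of twisted lattice
tensors over a common `(Y, β)`. [cite: KaniRosen1989, §3 Thm. B] [cite: SerreLinearRepresentations1977, §2.1 Prop. 2 and §2.6 Thm. 8]
[cite: LangeRodriguez2022, §2.9.1 Thm. 2.9.1 and Prop. 2.9.3 (PDF pp. 43, 46)] -/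
theorem dim_isotypical_eq_sum_of_trace_eq_sum {κ : Type} [Fintype κ] [DecidableEq κ] (b : Bicone (fun _ : κ ↦ Y))
    (m : G →* Matrix κ κ ℤ) (ρ : G →* End b.pt) {u : ratCharIdempotents G → (b.pt ⟶ b.pt)}
    (hu : ∀ e, End.of (u e) = ∑ g, a e g • ρ g) (hb : ∑ j, b.π j ≫ b.ι j = 𝟙 b.pt)
    (hbw : ∀ w, ∑ i, (bw w).π i ≫ (bw w).ι i = 𝟙 (bw w).pt)
    (hρ : ∀ (g : G) (i j : κ), b.ι j ≫ End.asHom (ρ g) ≫ b.π i = m g i j • End.asHom (β g))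
    (hρw : ∀ (w : W) (g : G) (i j : ι w), (bw w).ι j ≫ End.asHom (ρw w g) ≫ (bw w).π i = mw w g i j • End.asHom (β g))
    (htr : ∀ g : G, (m g).trace = ∑ w, (mw w g).trace) (e : ratCharIdempotents G) :
    (image (u e)).dim = ∑ w, (image (uw e w)).dim := by
  obtain ⟨ℓ, hℓp, hℓ⟩ := exists_prime_natCast_ne_zero (K := K)
  haveI : Fact ℓ.Prime := ⟨hℓp⟩
  have h := card_mul_two_mul_dim_isotypical_eq_sum_trace_mul b m β ρ ha hu ℓ hb hρ hℓ e
  have hw := fun w ↦ card_mul_two_mul_dim_isotypical_eq_sum_trace_mul (bw w) (mw w) β (ρw w) ha (huw · w) ℓ (hbw w) (hρw w) hℓ e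
  have key : ((Fintype.card G * (2 * (image (u e)).dim) : ℕ) : ℤ_[ℓ]) =
      ((Fintype.card G * (2 * ∑ w, (image (uw e w)).dim) : ℕ) : ℤ_[ℓ]) := by
    rw [h, Finset.mul_sum, Finset.mul_sum, Nat.cast_sum, Finset.sum_congr rfl fun w _ ↦ hw w, Finset.sum_comm]
    refine Finset.sum_congr rfl fun g _ ↦ ?_
    rw [htr g, Int.cast_sum, Finset.sum_mul, Finset.mul_sum]
  have key' := Nat.eq_of_mul_eq_mul_left (Fintype.card_pos (α := G)) (Nat.cast_injective key)
  omega

end Relations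

/-! ## §2 Twisted decomposition numerics: `M_ℚ ≅ ⊕_w (M_w)_ℚ ⟹ dim B_H`, `dim B_W` of `Y ⊗_β M` are the sums over `w` -/

section Twisted

variable {Y : AbelianVariety K} {κ : Type} [Fintype κ] [DecidableEq κ] (b : Bicone (fun _ : κ ↦ Y))
  {W : Type} [Fintype W] [DecidableEq W] {ι : W → Type} [∀ w, Fintype (ι w)] [∀ w, DecidableEq (ι w)]
  (bw : ∀ w, Bicone (fun _ : ι w ↦ Y))
  {G : Type} [Group G] (m : G →* Matrix κ κ ℤ) (mw : ∀ w, G →* Matrix (ι w) (ι w) ℤ) (β : G →* End Y)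
  (ρ : G →* End b.pt) (ρw : ∀ w, G →* End (bw w).pt)

/-- **`dim B_H(Y ⊗_β M) = Σ_w dim B_H(Y ⊗_β M_w)` over ANY field when `M_ℚ ≅ ⊕_w (M_w)_ℚ`, for TWISTED tensors** (integral intertwiner
`P m(g) = diag(m_w(g))_w P` with a quasi-inverse; `H` a finite subgroup; no bicone over the family needed): `tr m = Σ_w tr m_w` and §1 —
"`Res V ∼ ⊕_ρ I_ρ ⊗ V`" factor by factor. [cite: MazurRubinSilverberg2007, Cor. 2.5, Def. 4.3 and Thm. 4.5] [cite: KaniRosen1989, §3 Thm. B]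
[cite: LangeRodriguez2022, §2.9.1 Prop. 2.9.3 (PDF p. 46)] -/
theorem dim_image_norm_eq_sum_of_intertwines_twisted {H : Subgroup G} [Fintype H] (hb : ∑ j, b.π j ≫ b.ι j = 𝟙 b.pt)
    (hbw : ∀ w, ∑ i, (bw w).π i ≫ (bw w).ι i = 𝟙 (bw w).pt)
    (hρ : ∀ (g : G) (i j : κ), b.ι j ≫ End.asHom (ρ g) ≫ b.π i = m g i j • End.asHom (β g))
    (hρw : ∀ (w : W) (g : G) (i j : ι w), (bw w).ι j ≫ End.asHom (ρw w g) ≫ (bw w).π i = mw w g i j • End.asHom (β g))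
    {P : Matrix (Σ w, ι w) κ ℤ} {Q : Matrix κ (Σ w, ι w) ℤ} {d : ℤ}
    (hP : ∀ g : G, P * m g = (Matrix.blockDiagonal' fun w ↦ mw w g) * P)
    (hQP : Q * P = d • (1 : Matrix κ κ ℤ)) (hPQ : P * Q = d • (1 : Matrix (Σ w, ι w) (Σ w, ι w) ℤ)) (hd : d ≠ 0)
    {N : b.pt ⟶ b.pt} (hN : End.of N = ∑ h : H, ρ h) {Nw : ∀ w, (bw w).pt ⟶ (bw w).pt}
    (hNw : ∀ w, End.of (Nw w) = ∑ h : H, ρw w h) :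
    (image N).dim = ∑ w, (image (Nw w)).dim :=
  dim_image_norm_eq_sum_of_trace_eq_sum bw mw β ρw b m ρ hb hbw hρ hρw
    (fun h ↦ trace_eq_sum_trace_of_intertwines m mw hP hQP hPQ hd (h : G)) hN hNw

/-- **Binary form: `dim B_H(Y ⊗_β M) = dim B_H(Y ⊗_β M₁) + dim B_H(Y ⊗_β M₂)` over ANY field when `M_ℚ ≅ (M₁ ⊕ M₂)_ℚ`, for TWISTED
tensors** (`P m(g) = diag(m₁(g), m₂(g)) P` with a quasi-inverse). [cite: MazurRubinSilverberg2007, Cor. 2.5 and Thm. 4.5]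
[cite: KaniRosen1989, §3 Thm. B] [cite: LangeRodriguez2022, §2.9.1 Prop. 2.9.3 (PDF p. 46)] -/
theorem dim_image_norm_eq_add_of_intertwines_twisted {ι₁ ι₂ : Type} [Fintype ι₁] [Fintype ι₂] [DecidableEq ι₁] [DecidableEq ι₂]
    (b₁ : Bicone (fun _ : ι₁ ↦ Y)) (b₂ : Bicone (fun _ : ι₂ ↦ Y)) (m₁ : G →* Matrix ι₁ ι₁ ℤ) (m₂ : G →* Matrix ι₂ ι₂ ℤ)
    (ρ₁ : G →* End b₁.pt) (ρ₂ : G →* End b₂.pt) {H : Subgroup G} [Fintype H] (hb : ∑ j, b.π j ≫ b.ι j = 𝟙 b.pt)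
    (hb₁ : ∑ j, b₁.π j ≫ b₁.ι j = 𝟙 b₁.pt) (hb₂ : ∑ l, b₂.π l ≫ b₂.ι l = 𝟙 b₂.pt)
    (hρ : ∀ (g : G) (i j : κ), b.ι j ≫ End.asHom (ρ g) ≫ b.π i = m g i j • End.asHom (β g))
    (hρ₁ : ∀ (g : G) (i j : ι₁), b₁.ι j ≫ End.asHom (ρ₁ g) ≫ b₁.π i = m₁ g i j • End.asHom (β g))
    (hρ₂ : ∀ (g : G) (i j : ι₂), b₂.ι j ≫ End.asHom (ρ₂ g) ≫ b₂.π i = m₂ g i j • End.asHom (β g))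
    {P : Matrix (ι₁ ⊕ ι₂) κ ℤ} {Q : Matrix κ (ι₁ ⊕ ι₂) ℤ} {d : ℤ}
    (hP : ∀ g : G, P * m g = Matrix.fromBlocks (m₁ g) 0 0 (m₂ g) * P)
    (hQP : Q * P = d • (1 : Matrix κ κ ℤ)) (hPQ : P * Q = d • (1 : Matrix (ι₁ ⊕ ι₂) (ι₁ ⊕ ι₂) ℤ)) (hd : d ≠ 0)
    {N : b.pt ⟶ b.pt} (hN : End.of N = ∑ h : H, ρ h) {N₁ : b₁.pt ⟶ b₁.pt} (hN₁ : End.of N₁ = ∑ h : H, ρ₁ h)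
    {N₂ : b₂.pt ⟶ b₂.pt} (hN₂ : End.of N₂ = ∑ h : H, ρ₂ h) :
    (image N).dim = (image N₁).dim + (image N₂).dim := by
  obtain ⟨ℓ, hℓp, hℓ⟩ := exists_prime_natCast_ne_zero (K := K)
  haveI : Fact ℓ.Prime := ⟨hℓp⟩
  have h := card_mul_two_mul_dim_image_norm_eq_sum_trace_mul b m β ρ ℓ hb hρ hℓ hN
  have h₁ := card_mul_two_mul_dim_image_norm_eq_sum_trace_mul b₁ m₁ β ρ₁ ℓ hb₁ hρ₁ hℓ hN₁
  have h₂ := card_mul_two_mul_dim_image_norm_eq_sum_trace_mul b₂ m₂ β ρ₂ ℓ hb₂ hρ₂ hℓ hN₂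
  have key : ((Fintype.card H * (2 * (image N).dim) : ℕ) : ℤ_[ℓ]) =
      ((Fintype.card H * (2 * (image N₁).dim) : ℕ) : ℤ_[ℓ]) + ((Fintype.card H * (2 * (image N₂).dim) : ℕ) : ℤ_[ℓ]) := by
    rw [h, h₁, h₂, ← Finset.sum_add_distrib]
    refine Finset.sum_congr rfl fun h' _ ↦ ?_
    rw [trace_eq_trace_add_trace_of_intertwines m m₁ m₂ hP hQP hPQ hd (h' : G), Int.cast_add, add_mul]
  have key' : Fintype.card H * (2 * (image N).dim) = Fintype.card H * (2 * (image N₁).dim) + Fintype.card H * (2 * (image N₂).dim) := by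
    exact_mod_cast key
  rw [← Nat.mul_add, ← Nat.mul_add] at key'
  have key'' := Nat.eq_of_mul_eq_mul_left (Fintype.card_pos (α := H)) key'
  omega

variable [Fintype G] {a : ratCharIdempotents G → G → ℤ}
  (ha : ∀ e : ratCharIdempotents G,
    (Fintype.card G : ℚ) • (e : MonoidAlgebra ℚ G) = ∑ g, (a e g : ℚ) • MonoidAlgebra.of ℚ G g)
  {u : ratCharIdempotents G → (b.pt ⟶ b.pt)} (hu : ∀ e, End.of (u e) = ∑ g, a e g • ρ g)

include ha hu

/-- **`dim B_W(Y ⊗_β M) = Σ_w dim B_W(Y ⊗_β M_w)` over ANY field when `M_ℚ ≅ ⊕_w (M_w)_ℚ`, for TWISTED tensors and every isotypical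
component** (`B_W = Im u_W`, same coefficient vectors `c_W` throughout). [cite: MazurRubinSilverberg2007, Cor. 2.5, Def. 4.3 and Thm. 4.5]
[cite: LangeRodriguez2022, §2.9.1 Thm. 2.9.1 and Prop. 2.9.3 (PDF pp. 43, 46)] [cite: SerreLinearRepresentations1977, §2.6 Thm. 8] -/
theorem dim_isotypical_eq_sum_of_intertwines_twisted {uw : ratCharIdempotents G → ∀ w, ((bw w).pt ⟶ (bw w).pt)}
    (huw : ∀ e w, End.of (uw e w) = ∑ g, a e g • ρw w g) (hb : ∑ j, b.π j ≫ b.ι j = 𝟙 b.pt)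
    (hbw : ∀ w, ∑ i, (bw w).π i ≫ (bw w).ι i = 𝟙 (bw w).pt)
    (hρ : ∀ (g : G) (i j : κ), b.ι j ≫ End.asHom (ρ g) ≫ b.π i = m g i j • End.asHom (β g))
    (hρw : ∀ (w : W) (g : G) (i j : ι w), (bw w).ι j ≫ End.asHom (ρw w g) ≫ (bw w).π i = mw w g i j • End.asHom (β g))
    {P : Matrix (Σ w, ι w) κ ℤ} {Q : Matrix κ (Σ w, ι w) ℤ} {d : ℤ}
    (hP : ∀ g : G, P * m g = (Matrix.blockDiagonal' fun w ↦ mw w g) * P)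
    (hQP : Q * P = d • (1 : Matrix κ κ ℤ)) (hPQ : P * Q = d • (1 : Matrix (Σ w, ι w) (Σ w, ι w) ℤ)) (hd : d ≠ 0)
    (e : ratCharIdempotents G) :
    (image (u e)).dim = ∑ w, (image (uw e w)).dim :=
  dim_isotypical_eq_sum_of_trace_eq_sum bw mw β ρw ha huw b m ρ hu hb hbw hρ hρw
    (fun g ↦ trace_eq_sum_trace_of_intertwines m mw hP hQP hPQ hd g) e

/-- **Binary form: `dim B_W(Y ⊗_β M) = dim B_W(Y ⊗_β M₁) + dim B_W(Y ⊗_β M₂)` over ANY field when `M_ℚ ≅ (M₁ ⊕ M₂)_ℚ`, for TWISTED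
tensors and every isotypical component.** [cite: MazurRubinSilverberg2007, Cor. 2.5 and Thm. 4.5]
[cite: LangeRodriguez2022, §2.9.1 Thm. 2.9.1 and Prop. 2.9.3 (PDF pp. 43, 46)] [cite: SerreLinearRepresentations1977, §2.6 Thm. 8] -/
theorem dim_isotypical_eq_add_of_intertwines_twisted {ι₁ ι₂ : Type} [Fintype ι₁] [Fintype ι₂] [DecidableEq ι₁] [DecidableEq ι₂]
    (b₁ : Bicone (fun _ : ι₁ ↦ Y)) (b₂ : Bicone (fun _ : ι₂ ↦ Y)) (m₁ : G →* Matrix ι₁ ι₁ ℤ) (m₂ : G →* Matrix ι₂ ι₂ ℤ)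
    (ρ₁ : G →* End b₁.pt) (ρ₂ : G →* End b₂.pt) {u₁ : ratCharIdempotents G → (b₁.pt ⟶ b₁.pt)}
    (hu₁ : ∀ e, End.of (u₁ e) = ∑ g, a e g • ρ₁ g) {u₂ : ratCharIdempotents G → (b₂.pt ⟶ b₂.pt)}
    (hu₂ : ∀ e, End.of (u₂ e) = ∑ g, a e g • ρ₂ g) (hb : ∑ j, b.π j ≫ b.ι j = 𝟙 b.pt)
    (hb₁ : ∑ j, b₁.π j ≫ b₁.ι j = 𝟙 b₁.pt) (hb₂ : ∑ l, b₂.π l ≫ b₂.ι l = 𝟙 b₂.pt)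
    (hρ : ∀ (g : G) (i j : κ), b.ι j ≫ End.asHom (ρ g) ≫ b.π i = m g i j • End.asHom (β g))
    (hρ₁ : ∀ (g : G) (i j : ι₁), b₁.ι j ≫ End.asHom (ρ₁ g) ≫ b₁.π i = m₁ g i j • End.asHom (β g))
    (hρ₂ : ∀ (g : G) (i j : ι₂), b₂.ι j ≫ End.asHom (ρ₂ g) ≫ b₂.π i = m₂ g i j • End.asHom (β g))
    {P : Matrix (ι₁ ⊕ ι₂) κ ℤ} {Q : Matrix κ (ι₁ ⊕ ι₂) ℤ} {d : ℤ}
    (hP : ∀ g : G, P * m g = Matrix.fromBlocks (m₁ g) 0 0 (m₂ g) * P)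
    (hQP : Q * P = d • (1 : Matrix κ κ ℤ)) (hPQ : P * Q = d • (1 : Matrix (ι₁ ⊕ ι₂) (ι₁ ⊕ ι₂) ℤ)) (hd : d ≠ 0)
    (e : ratCharIdempotents G) :
    (image (u e)).dim = (image (u₁ e)).dim + (image (u₂ e)).dim := by
  obtain ⟨ℓ, hℓp, hℓ⟩ := exists_prime_natCast_ne_zero (K := K)
  haveI : Fact ℓ.Prime := ⟨hℓp⟩
  have h := card_mul_two_mul_dim_isotypical_eq_sum_trace_mul b m β ρ ha hu ℓ hb hρ hℓ e
  have h₁ := card_mul_two_mul_dim_isotypical_eq_sum_trace_mul b₁ m₁ β ρ₁ ha hu₁ ℓ hb₁ hρ₁ hℓ e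
  have h₂ := card_mul_two_mul_dim_isotypical_eq_sum_trace_mul b₂ m₂ β ρ₂ ha hu₂ ℓ hb₂ hρ₂ hℓ e
  have key : ((Fintype.card G * (2 * (image (u e)).dim) : ℕ) : ℤ_[ℓ]) =
      ((Fintype.card G * (2 * (image (u₁ e)).dim) : ℕ) : ℤ_[ℓ]) + ((Fintype.card G * (2 * (image (u₂ e)).dim) : ℕ) : ℤ_[ℓ]) := by
    rw [h, h₁, h₂, ← Finset.sum_add_distrib]
    refine Finset.sum_congr rfl fun g _ ↦ ?_
    rw [trace_eq_trace_add_trace_of_intertwines m m₁ m₂ hP hQP hPQ hd g, Int.cast_add, add_mul, mul_add]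
  have key' : Fintype.card G * (2 * (image (u e)).dim) =
      Fintype.card G * (2 * (image (u₁ e)).dim) + Fintype.card G * (2 * (image (u₂ e)).dim) := by
    exact_mod_cast key
  rw [← Nat.mul_add, ← Nat.mul_add] at key'
  have key'' := Nat.eq_of_mul_eq_mul_left (Fintype.card_pos (α := G)) key'
  omega

end Twisted

end LatticeTensor

end AbelianVariety

end Literature.AlgebraicGeometry.Motives
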